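import Summits.Ventures.Crystal3D.Theorems.StickyWulffConstantCoaxialWallLawExitsBelow
import HarnessLib

/-!
# Lane G's general-filling rung, modulo twin caps, holds for every pair with distinct LINEAR lattices
# — in particular for every co-axial TWIN pair

HONEST FRAMING. Part of the venture `Summits/Ventures/Crystal3D` (cell `crystal3d-full`), helper
`--supports` the crux `CoaxialWallLaw` (stmt-Ventures-19481, `route-Ventures-StickyWulffConstant`),
REGISTERED line `WallLedgerF` (planner cf-p1 gen 16), stub `stub_coaxialTwoSlabAdhesion`.
RUNG CREDIT ONLY; F-C1 not moved.

19480-p1 g3's `general_twoSlabAdhesion_modulo_twinCaps` (`…GenericWallFloorGeneralRung`) assumes only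
that the two slot sets differ (`¬ ∀ w, A₁ w ∈ A₂·Λ₀` and symmetrically).  By `image_fcc_eq_of_slots_mem`
(`…CoaxialWallLawExitsBelow`) this is EQUIVALENT to `A₁·Λ₀ ≠ A₂·Λ₀`, which holds for every twin pair,
co-axial or not (CSL or not).  So the general-filling inequality with charge `1/3770` and the twin-capped
exits as residual holds for co-axial twin pairs VERBATIM (`general_twoSlabAdhesion_modulo_twinCaps_of_linear_ne`).
READING FOR LINE F: this is NOT F's inequality — F's main term is `φ₁ + φ₂ − ½·sin θ` and the cheap
staircase filling of a co-axial twin cell has `#TC ~ π ρ²` (every steep line crossing a coherent terrace is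
a twin-capped exit); F's content is the bound on `#TC` by the RISERS between coincidence terraces (folder
memo).  Translation pairs (`A₁·Λ₀ = A₂·Λ₀`) are outside this theorem (use `…ExitsOnGrain`).
-/

noncomputable section

namespace Summit.Ventures.Crystal3D.Theorems

open Summit.Ventures.Crystal3D Finset
open Literature.MathematicalPhysics.StatisticalMechanics (fccStacking contactDeficiency)
open scoped InnerProductSpace

open scoped Classical in
/-- **Lane G's general rung for pairs with distinct linear lattices** (all twin pairs, incl. co-axial). -/
theorem general_twoSlabAdhesion_modulo_twinCaps_of_linear_ne {δ : ℝ} (hg : KissingGap δ)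
    (hc : KissingClassification δ)
    (A₁ : EuclideanSpace ℝ (Fin 3) ≃ₗᵢ[ℝ] EuclideanSpace ℝ (Fin 3)) (t₁ : EuclideanSpace ℝ (Fin 3))
    (A₂ : EuclideanSpace ℝ (Fin 3) ≃ₗᵢ[ℝ] EuclideanSpace ℝ (Fin 3)) (t₂ : EuclideanSpace ℝ (Fin 3))
    (hlin : A₁ '' fccStacking 1 (Real.sqrt (2 / 3)) ≠ A₂ '' fccStacking 1 (Real.sqrt (2 / 3)))
    {u₁ : EuclideanSpace ℝ (Fin 3)} (hu₁ : u₁ ∈ fccSlots)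
    (hsteep₁ : Real.sqrt 2 / 2 ≤ ⟪A₁ u₁, EuclideanSpace.single (2 : Fin 3) (1 : ℝ)⟫_ℝ)
    {u₂ : EuclideanSpace ℝ (Fin 3)} (hu₂ : u₂ ∈ fccSlots)
    (hsteep₂ : ⟪A₂ u₂, EuclideanSpace.single (2 : Fin 3) (1 : ℝ)⟫_ℝ ≤ -(Real.sqrt 2 / 2)) :
    ∃ C R₀ : ℝ, 1 ≤ R₀ ∧ ∀ h : ℝ, 0 ≤ h → ∀ ρ : ℝ, R₀ ≤ ρ →
      ∀ X P₁ P₂ : Finset (EuclideanSpace ℝ (Fin 3)),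
      (∀ p ∈ X, ∀ q ∈ X, p ≠ q → 1 ≤ dist p q) → P₁ ⊆ X → P₂ ⊆ X \ P₁ →
      (∀ p ∈ X, -(2 * R₀) ≤ p 2 ∧ p 2 ≤ h + 2 * R₀ ∧ p 0 ^ 2 + p 1 ^ 2 ≤ ρ ^ 2) →
      (∀ p, p ∈ P₁ ↔ (p ∈ (fun q => A₁ q + t₁) '' fccStacking 1 (Real.sqrt (2 / 3)) ∧
        -(2 * R₀) ≤ p 2 ∧ p 2 ≤ -R₀ ∧ p 0 ^ 2 + p 1 ^ 2 ≤ ρ ^ 2)) →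
      (∀ p, p ∈ P₂ ↔ (p ∈ (fun q => A₂ q + t₂) '' fccStacking 1 (Real.sqrt (2 / 3)) ∧
        h + R₀ ≤ p 2 ∧ p 2 ≤ h + 2 * R₀ ∧ p 0 ^ 2 + p 1 ^ 2 ≤ ρ ^ 2)) →
      -- CLEAN outer slivers
      (∀ p ∈ X, p 2 < -(2 * R₀) + 1 → p ∈ (fun q => A₁ q + t₁) '' fccStacking 1 (Real.sqrt (2 / 3))) →
      (∀ p ∈ X, h + 2 * R₀ - 1 < p 2 → p ∈ (fun q => A₂ q + t₂) '' fccStacking 1 (Real.sqrt (2 / 3))) →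
      ((((P₁ ×ˢ (X \ P₁)).filter fun pq => dist pq.1 pq.2 = 1).card : ℕ) : ℝ) +
        ((((P₂ ×ˢ ((X \ P₁) \ P₂)).filter fun pq => dist pq.1 pq.2 = 1).card : ℕ) : ℝ) ≤
        contactDeficiency ((X \ P₁) \ P₂) +
          (Real.sqrt 2 / 4 * ∑ᶠ w ∈ {w ∈ fccStacking 1 (Real.sqrt (2 / 3)) | ‖w‖ = 1},
              |⟪w, A₁.symm (EuclideanSpace.single (2 : Fin 3) (1 : ℝ))⟫_ℝ| +
            Real.sqrt 2 / 4 * ∑ᶠ w ∈ {w ∈ fccStacking 1 (Real.sqrt (2 / 3)) | ‖w‖ = 1},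
              |⟪w, A₂.symm (EuclideanSpace.single (2 : Fin 3) (1 : ℝ))⟫_ℝ| - 1 / 3770) * Real.pi * ρ ^ 2 +
          (((((X.filter fun e => e - A₁ u₁ ∈ X ∧ (∀ w ∈ fccSlots, e - A₁ u₁ + A₁ w ∈ X) ∧
                ∃ v ∈ fccSlots, e + A₁ v ∉ X).filter fun e => ∃ n : EuclideanSpace ℝ (Fin 3), ‖n‖ = 1 ∧
              (∀ w ∈ fccSlots, ⟪A₁ w, n⟫_ℝ = 0 ∨ ⟪A₁ w, n⟫_ℝ = Real.sqrt (2 / 3) ∨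
                ⟪A₁ w, n⟫_ℝ = -Real.sqrt (2 / 3)) ∧
              ⟪A₁ u₁, n⟫_ℝ = Real.sqrt (2 / 3) ∧
              (∀ w ∈ fccSlots, ⟪A₁ w, n⟫_ℝ ≤ 0 → e + A₁ w ∈ X) ∧
              (∀ w ∈ fccSlots, 0 < ⟪A₁ w, n⟫_ℝ → e + A₁ w ∉ X ∧ e - A₁ w + (2 * ⟪A₁ w, n⟫_ℝ) • n ∈ X)).card
              : ℕ) : ℝ) +
           ((((X.filter fun e => e - A₂ u₂ ∈ X ∧ (∀ w ∈ fccSlots, e - A₂ u₂ + A₂ w ∈ X) ∧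
                ∃ v ∈ fccSlots, e + A₂ v ∉ X).filter fun e => ∃ n : EuclideanSpace ℝ (Fin 3), ‖n‖ = 1 ∧
              (∀ w ∈ fccSlots, ⟪A₂ w, n⟫_ℝ = 0 ∨ ⟪A₂ w, n⟫_ℝ = Real.sqrt (2 / 3) ∨
                ⟪A₂ w, n⟫_ℝ = -Real.sqrt (2 / 3)) ∧
              ⟪A₂ u₂, n⟫_ℝ = Real.sqrt (2 / 3) ∧
              (∀ w ∈ fccSlots, ⟪A₂ w, n⟫_ℝ ≤ 0 → e + A₂ w ∈ X) ∧
              (∀ w ∈ fccSlots, 0 < ⟪A₂ w, n⟫_ℝ → e + A₂ w ∉ X ∧ e - A₂ w + (2 * ⟪A₂ w, n⟫_ℝ) • n ∈ X)).card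
              : ℕ) : ℝ)) / 7540 +
          C * (1 + h) * ρ :=
  general_twoSlabAdhesion_modulo_twinCaps hg hc A₁ t₁ A₂ t₂
    (fun h => hlin (image_fcc_eq_of_slots_mem A₁ A₂ h))
    (fun h => hlin (image_fcc_eq_of_slots_mem A₂ A₁ h).symm) hu₁ hsteep₁ hu₂ hsteep₂

end Summit.Ventures.Crystal3D.Theorems

end
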